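import Summits.AtomisticToContinuum.Crystallization.Theorems.FrustratedLawDichotomyLocalCloseOrderUniform
import Summits.AtomisticToContinuum.Crystallization.Theorems.RepetitiveNetworkReductionRecurrentMemberEngine

/-!
# FrustratedLawDichotomy · crux `AperiodicFrustratedLawGap` (stmt-AtomisticToContinuum-27623) — THE LOCAL-CLOSE-ORDER STATEMENT REDUCES TO
# UNIFORMLY RECURRENT (REPETITIVE) EXACT μ-EQUILIBRIA (decomp-a2c, prover hand 2, structural share, generation 7; route-independent module)

`LCO` (`FrustratedLawDichotomyLocalCloseOrder`): every rooted `7/10`-separated `e⋆`-μGSC of `V_LJ` has a robustly good atom.  This file proves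
the aperiodic-order reduction

* `localCloseOrder_of_recurrent` : `LCO_rec → LCO`, where `LCO_rec` asks the same ONLY for configurations that are UNIFORMLY RECURRENT about
  the root (every `(R, ε)`-patch about `0` reappears, up to an `ε`-matching `BallMatch ε R 0 (Z − g) Z`, about an atom `g` within bounded
  distance `G(R, ε)` of EVERY atom — lens-2's `URS`, the repetitivity of aperiodic order).

Proof: the family `𝒞` of rooted `7/10`-separated `e⋆`-μGSCs WITHOUT a robustly good atom is closed under re-rooting (`isMuGSC_image_sub`,
`robustGood_translate`) and under local limits (`isMuGSC_of_limit`; robust goodness is OPEN — `robustGood_transfer` — so its absence is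
closed), hence, if non-empty, contains a uniformly recurrent member by lens-2's hull engine
`RepetitiveNetworkReductionRecurrentMember.exists_mem_uniformlyRecurrent` (Birkhoff minimality in the local matching topology); `LCO_rec`
gives that member a good atom — contradiction.  So the only configurations on which the crux's open core (in the `LCO`/`FDG` currency of this
generation) has to be fought are REPETITIVE everywhere-frustrated exact μ-equilibria: quasicrystal-like or limit-periodic textures, never
glasses.  Concordance: this is the configuration-level twin of lens-2's law-level repetitive reduction (`RepetitiveNetworkReduction`, item 27568,
`stub_repetitiveReduction`).  `[folklore]` bookkeeping.
-/

noncomputable section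

namespace Summit.AtomisticToContinuum.Crystallization.Theorems.FrustratedLawDichotomyLocalCloseOrderRecurrent

open Filter Topology Metric
open Literature.MathematicalPhysics.StatisticalMechanics
open Literature.Geometry.DiscreteGeometry
open Summit.AtomisticToContinuum.Crystallization.Theorems.FrustratedLawDichotomyLocalCloseOrderStability (robustGood_transfer)
open Summit.AtomisticToContinuum.Crystallization.Theorems.FrustratedLawDichotomyLocalCloseOrderUniform (robustGood_translate)
open Summit.AtomisticToContinuum.Crystallization.Theorems.RepetitiveNetworkReductionRecurrentMember
  (isMuGSC_of_limit isMuGSC_image_sub exists_mem_uniformlyRecurrent)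

/-- **Robust goodness passes to a matched configuration** (packaging of `robustGood_transfer` in the clause shape of `LCO`): if `Y'` is
`7/10`-separated and `BallMatch ε R 0 Y' Y` with `ε = min (min (γ/10) ((1/20 − η)·d/10)) (1/10)` and `R = ‖p‖ + 13/10·d + γ + ε`, a robustly
good atom `p` of `Y` (pattern `Pat` of unit vectors, data `(d, η, γ, A, t)`) yields a robustly good atom of `Y'`. [folklore] -/
theorem exists_robustGood_of_ballMatch {Y Y' : Set (EuclideanSpace ℝ (Fin 3))} (hY' : ∀ a ∈ Y', ∀ b ∈ Y', a ≠ b → (7 : ℝ) / 10 ≤ dist a b)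
    {Pat : Finset (EuclideanSpace ℝ (Fin 3))} (hPat : Pat.Nonempty) (hPatn : ∀ u ∈ Pat, ‖u‖ = 1)
    {p : EuclideanSpace ℝ (Fin 3)} (hp : p ∈ Y) {d η γ : ℝ} {A : EuclideanSpace ℝ (Fin 3) →ₗᵢ[ℝ] EuclideanSpace ℝ (Fin 3)} {t : ↥Pat → EuclideanSpace ℝ (Fin 3)}
    (h : 0 < d ∧ 0 < γ ∧ η < 1 / 20 ∧ (∀ u : ↥Pat, t u ∈ Y ∧ ‖(t u - p) - d • A (u : EuclideanSpace ℝ (Fin 3))‖ ≤ η * d) ∧ (∀ s : EuclideanSpace ℝ (Fin 3), s ∈ Y → s ≠ p → d ≤ dist s p) ∧ (∃ s : EuclideanSpace ℝ (Fin 3), s ∈ Y ∧ s ≠ p ∧ dist s p ≤ d) ∧ (∀ s : EuclideanSpace ℝ (Fin 3), s ∈ Y → s ≠ p → dist s p < 13 / 10 * d + γ → dist s p ≤ 13 / 10 * d - γ ∧ s ∈ Set.range t))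
    (hBM : BallMatch (min (min (γ / 10) ((1 / 20 - η) * d / 10)) (1 / 10)) (‖p‖ + 13 / 10 * d + γ + min (min (γ / 10) ((1 / 20 - η) * d / 10)) (1 / 10)) 0 Y' Y) :
    ∃ p' : EuclideanSpace ℝ (Fin 3), p' ∈ Y' ∧ ∃ (d' : ℝ) (t' : ↥Pat → EuclideanSpace ℝ (Fin 3)), 0 < d' ∧ 0 < (γ / 2) ∧ ((1 / 20 + η) / 2) < 1 / 20 ∧ (∀ u : ↥Pat, t' u ∈ Y' ∧ ‖(t' u - p') - d' • A (u : EuclideanSpace ℝ (Fin 3))‖ ≤ ((1 / 20 + η) / 2) * d') ∧ (∀ s : EuclideanSpace ℝ (Fin 3), s ∈ Y' → s ≠ p' → d' ≤ dist s p') ∧ (∃ s : EuclideanSpace ℝ (Fin 3), s ∈ Y' ∧ s ≠ p' ∧ dist s p' ≤ d') ∧ (∀ s : EuclideanSpace ℝ (Fin 3), s ∈ Y' → s ≠ p' → dist s p' < 13 / 10 * d' + (γ / 2) → dist s p' ≤ 13 / 10 * d' - (γ / 2) ∧ s ∈ Set.range t') := by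
  obtain ⟨hd, hγ, hη, ht, hnn₁, hnn₂, hgap⟩ := h
  have hηd : 0 < (1 / 20 - η) * d := mul_pos (by linarith) hd
  have hε : 0 < min (min (γ / 10) ((1 / 20 - η) * d / 10)) (1 / 10) := by positivity
  have hεm : min (min (γ / 10) ((1 / 20 - η) * d / 10)) (1 / 10) ≤ min (γ / 10) ((1 / 20 - η) * d / 10) := min_le_left _ _
  have hm₁ : min (γ / 10) ((1 / 20 - η) * d / 10) ≤ γ / 10 := min_le_left _ _
  have hm₂ : min (γ / 10) ((1 / 20 - η) * d / 10) ≤ (1 / 20 - η) * d / 10 := min_le_right _ _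
  have hε10 : min (min (γ / 10) ((1 / 20 - η) * d / 10)) (1 / 10) ≤ 1 / 10 := min_le_right _ _
  obtain ⟨hmA, hmB⟩ := hBM
  obtain ⟨p', hp'Y, -, d', t', -, hd'pos, ht', hnn₁', hnn₂', hgap'⟩ :=
    robustGood_transfer hY' (fun s hs hsR => hmA s hs (by rwa [dist_zero_right]))
      (fun a ha haR => hmB a ha (by rwa [dist_zero_right])) hPat hPatn hp hd hη ht hnn₁ hnn₂ hgap hε (by linarith) (by linarith)
      (by linarith) le_rfl
  exact ⟨p', hp'Y, d', t', hd'pos, by linarith, by linarith, ht', hnn₁', hnn₂', hgap'⟩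

/-- **`LCO_rec → LCO`: it suffices to find close-packed order in UNIFORMLY RECURRENT exact μ-equilibria** (module docstring). [folklore] -/
theorem localCloseOrder_of_recurrent
    (hrec : ∀ X : Set (EuclideanSpace ℝ (Fin 3)), (0 : EuclideanSpace ℝ (Fin 3)) ∈ X → (∀ a ∈ X, ∀ b ∈ X, a ≠ b → (7 : ℝ) / 10 ≤ dist a b) → Literature.MathematicalPhysics.StatisticalMechanics.IsMuGSC Literature.MathematicalPhysics.StatisticalMechanics.lennardJones (⨅ Q : Literature.MathematicalPhysics.StatisticalMechanics.PeriodicConfiguration 3, Q.energyPerParticle Literature.MathematicalPhysics.StatisticalMechanics.lennardJones) X → (∀ R ε : ℝ, 0 < ε → ∃ G : ℝ, ∀ w ∈ X, ∃ g ∈ X, dist g w ≤ G ∧ Literature.MathematicalPhysics.StatisticalMechanics.BallMatch ε R 0 ((fun p => p - g) '' X) X) → ∃ p : EuclideanSpace ℝ (Fin 3), p ∈ X ∧ ∃ (d η γ : ℝ) (A : EuclideanSpace ℝ (Fin 3) →ₗᵢ[ℝ] EuclideanSpace ℝ (Fin 3)), (∃ t : ↥Literature.Geometry.DiscreteGeometry.fccKissingPattern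 → EuclideanSpace ℝ (Fin 3), 0 < d ∧ 0 < γ ∧ η < 1 / 20 ∧ (∀ u : ↥Literature.Geometry.DiscreteGeometry.fccKissingPattern, t u ∈ X ∧ ‖(t u - p) - d • A (u : EuclideanSpace ℝ (Fin 3))‖ ≤ η * d) ∧ (∀ s : EuclideanSpace ℝ (Fin 3), s ∈ X → s ≠ p → d ≤ dist s p) ∧ (∃ s : EuclideanSpace ℝ (Fin 3), s ∈ X ∧ s ≠ p ∧ dist s p ≤ d) ∧ (∀ s : EuclideanSpace ℝ (Fin 3), s ∈ X → s ≠ p → dist s p < 13 / 10 * d + γ → dist s p ≤ 13 / 10 * d - γ ∧ s ∈ Set.range t)) ∨ (∃ t : ↥Literature.Geometry.DiscreteGeometry.hcpKissingPattern → EuclideanSpace ℝ (Fin 3), 0 < d ∧ 0 < γ ∧ η < 1 / 20 ∧ (∀ u : ↥Literature.Geometry.DiscreteGeometry.hcpKissingPattern, t u ∈ X ∧ ‖(t u - p) - d • A (u : EuclideanSpace ℝ (Fin 3))‖ ≤ η * d) ∧ (∀ s : EuclideanSpace ℝ (Fin 3), s ∈ X → s ≠ p → d ≤ dist s p) ∧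 (∃ s : EuclideanSpace ℝ (Fin 3), s ∈ X ∧ s ≠ p ∧ dist s p ≤ d) ∧ (∀ s : EuclideanSpace ℝ (Fin 3), s ∈ X → s ≠ p → dist s p < 13 / 10 * d + γ → dist s p ≤ 13 / 10 * d - γ ∧ s ∈ Set.range t))) :
    ∀ X : Set (EuclideanSpace ℝ (Fin 3)), (0 : EuclideanSpace ℝ (Fin 3)) ∈ X → (∀ a ∈ X, ∀ b ∈ X, a ≠ b → (7 : ℝ) / 10 ≤ dist a b) → Literature.MathematicalPhysics.StatisticalMechanics.IsMuGSC Literature.MathematicalPhysics.StatisticalMechanics.lennardJones (⨅ Q : Literature.MathematicalPhysics.StatisticalMechanics.PeriodicConfiguration 3, Q.energyPerParticle Literature.MathematicalPhysics.StatisticalMechanics.lennardJones) X → ∃ p : EuclideanSpace ℝ (Fin 3), p ∈ X ∧ ∃ (d η γ : ℝ) (A : EuclideanSpace ℝ (Fin 3) →ₗᵢ[ℝ] EuclideanSpace ℝ (Fin 3)), (∃ t : ↥Literature.Geometry.DiscreteGeometry.fccKissingPattern → EuclideanSpace ℝ (Fin 3), 0 < d ∧ 0 < γ ∧ η < 1 /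 20 ∧ (∀ u : ↥Literature.Geometry.DiscreteGeometry.fccKissingPattern, t u ∈ X ∧ ‖(t u - p) - d • A (u : EuclideanSpace ℝ (Fin 3))‖ ≤ η * d) ∧ (∀ s : EuclideanSpace ℝ (Fin 3), s ∈ X → s ≠ p → d ≤ dist s p) ∧ (∃ s : EuclideanSpace ℝ (Fin 3), s ∈ X ∧ s ≠ p ∧ dist s p ≤ d) ∧ (∀ s : EuclideanSpace ℝ (Fin 3), s ∈ X → s ≠ p → dist s p < 13 / 10 * d + γ → dist s p ≤ 13 / 10 * d - γ ∧ s ∈ Set.range t)) ∨ (∃ t : ↥Literature.Geometry.DiscreteGeometry.hcpKissingPattern → EuclideanSpace ℝ (Fin 3), 0 < d ∧ 0 < γ ∧ η < 1 / 20 ∧ (∀ u : ↥Literature.Geometry.DiscreteGeometry.hcpKissingPattern, t u ∈ X ∧ ‖(t u - p) - d • A (u : EuclideanSpace ℝ (Fin 3))‖ ≤ η * d) ∧ (∀ s : EuclideanSpace ℝ (Fin 3), s ∈ X → s ≠ p → d ≤ dist s p) ∧ (∃ s : EuclideanSpace ℝ (Fin 3), s ∈ X ∧ s ≠ p ∧ dist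 s p ≤ d) ∧ (∀ s : EuclideanSpace ℝ (Fin 3), s ∈ X → s ≠ p → dist s p < 13 / 10 * d + γ → dist s p ≤ 13 / 10 * d - γ ∧ s ∈ Set.range t)) := by
  classical
  intro X h0 hsep hGSC
  by_contra hno
  -- the family of rooted separated exact μ-equilibria WITHOUT a robustly good atom
  set 𝒞 : Set (Set (EuclideanSpace ℝ (Fin 3))) := {Z | (0 : EuclideanSpace ℝ (Fin 3)) ∈ Z ∧ (∀ a ∈ Z, ∀ b ∈ Z, a ≠ b → (7 : ℝ) / 10 ≤ dist a b) ∧ Literature.MathematicalPhysics.StatisticalMechanics.IsMuGSC Literature.MathematicalPhysics.StatisticalMechanics.lennardJones (⨅ Q : Literature.MathematicalPhysics.StatisticalMechanics.PeriodicConfiguration 3, Q.energyPerParticle Literature.MathematicalPhysics.StatisticalMechanics.lennardJones) Z ∧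
      ¬ (∃ p : EuclideanSpace ℝ (Fin 3), p ∈ Z ∧ ∃ (d η γ : ℝ) (A : EuclideanSpace ℝ (Fin 3) →ₗᵢ[ℝ] EuclideanSpace ℝ (Fin 3)), (∃ t : ↥Literature.Geometry.DiscreteGeometry.fccKissingPattern → EuclideanSpace ℝ (Fin 3), 0 < d ∧ 0 < γ ∧ η < 1 / 20 ∧ (∀ u : ↥Literature.Geometry.DiscreteGeometry.fccKissingPattern, t u ∈ Z ∧ ‖(t u - p) - d • A (u : EuclideanSpace ℝ (Fin 3))‖ ≤ η * d) ∧ (∀ s : EuclideanSpace ℝ (Fin 3), s ∈ Z → s ≠ p → d ≤ dist s p) ∧ (∃ s : EuclideanSpace ℝ (Fin 3), s ∈ Z ∧ s ≠ p ∧ dist s p ≤ d) ∧ (∀ s : EuclideanSpace ℝ (Fin 3), s ∈ Z → s ≠ p → dist s p < 13 / 10 * d + γ → dist s p ≤ 13 / 10 * d - γ ∧ s ∈ Set.range t)) ∨ (∃ t : ↥Literature.Geometry.DiscreteGeometry.hcpKissingPattern → EuclideanSpace ℝ (Fin 3), 0 < d ∧ 0 < γ ∧ η < 1 / 20 ∧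 (∀ u : ↥Literature.Geometry.DiscreteGeometry.hcpKissingPattern, t u ∈ Z ∧ ‖(t u - p) - d • A (u : EuclideanSpace ℝ (Fin 3))‖ ≤ η * d) ∧ (∀ s : EuclideanSpace ℝ (Fin 3), s ∈ Z → s ≠ p → d ≤ dist s p) ∧ (∃ s : EuclideanSpace ℝ (Fin 3), s ∈ Z ∧ s ≠ p ∧ dist s p ≤ d) ∧ (∀ s : EuclideanSpace ℝ (Fin 3), s ∈ Z → s ≠ p → dist s p < 13 / 10 * d + γ → dist s p ≤ 13 / 10 * d - γ ∧ s ∈ Set.range t)))} with h𝒞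
  have hX : X ∈ 𝒞 := ⟨h0, hsep, hGSC, hno⟩
  -- closed under re-rooting
  have hroot : ∀ Z ∈ 𝒞, ∀ z ∈ Z, (fun p => p - z) '' Z ∈ 𝒞 := by
    rintro Z ⟨hZ0, hZsep, hZG, hZno⟩ z hz
    have hsep' : ∀ a ∈ (fun p => p - z) '' Z, ∀ b ∈ (fun p => p - z) '' Z, a ≠ b → (7 : ℝ) / 10 ≤ dist a b := by
      rintro _ ⟨a, ha, rfl⟩ _ ⟨b, hb, rfl⟩ hne
      rw [dist_sub_right]; exact hZsep a ha b hb fun h => hne (by rw [h])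
    refine ⟨⟨z, hz, sub_self z⟩, hsep', isMuGSC_image_sub (by norm_num : (0 : ℝ) < 7 / 10) hZsep hZG z, ?_⟩
    rintro ⟨p, hp, d, η, γ, A, hgood⟩
    obtain ⟨x, hx, hxp⟩ := hp
    have hpz : p + z ∈ Z := by rw [← hxp, sub_add_cancel]; exact hx
    rcases hgood with ⟨t, hg⟩ | ⟨t, hg⟩
    · exact hZno ⟨p + z, hpz, d, η, γ, A, Or.inl ⟨fun u => t u + z, robustGood_translate hg⟩⟩
    · exact hZno ⟨p + z, hpz, d, η, γ, A, Or.inr ⟨fun u => t u + z, robustGood_translate hg⟩⟩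
  -- closed under local limits
  have hclosed : ∀ Zs : ℕ → Set (EuclideanSpace ℝ (Fin 3)), (∀ k, Zs k ∈ 𝒞) → ∀ Z : Set (EuclideanSpace ℝ (Fin 3)), (0 : EuclideanSpace ℝ (Fin 3)) ∈ Z →
      (∀ p ∈ Z, ∀ q ∈ Z, p ≠ q → (7 : ℝ) / 10 ≤ dist p q) →
      (∀ R ε : ℝ, 0 < ε → ∀ᶠ k in atTop, BallMatch ε R 0 (Zs k) Z) → Z ∈ 𝒞 := by
    intro Zs hZs Z hZ0 hZsep hconv
    refine ⟨hZ0, hZsep, isMuGSC_of_limit (by norm_num : (0 : ℝ) < 7 / 10) (fun k => (hZs k).2.1) (fun k => (hZs k).2.2.1) hZsep hconv, ?_⟩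
    rintro ⟨p, hp, d, η, γ, A, hgood⟩
    -- a robustly good atom of the limit reappears in a near approximant
    have key : ∀ (Pat : Finset (EuclideanSpace ℝ (Fin 3))), Pat.Nonempty → (∀ u ∈ Pat, ‖u‖ = 1) → ∀ t : ↥Pat → EuclideanSpace ℝ (Fin 3),
        (0 < d ∧ 0 < γ ∧ η < 1 / 20 ∧ (∀ u : ↥Pat, t u ∈ Z ∧ ‖(t u - p) - d • A (u : EuclideanSpace ℝ (Fin 3))‖ ≤ η * d) ∧ (∀ s : EuclideanSpace ℝ (Fin 3), s ∈ Z → s ≠ p → d ≤ dist s p) ∧ (∃ s : EuclideanSpace ℝ (Fin 3), s ∈ Z ∧ s ≠ p ∧ dist s p ≤ d) ∧ (∀ s : EuclideanSpace ℝ (Fin 3), s ∈ Z → s ≠ p → dist s p < 13 / 10 * d + γ → dist s p ≤ 13 / 10 * d - γ ∧ s ∈ Set.range t)) →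
        ∃ k : ℕ, ∃ p' : EuclideanSpace ℝ (Fin 3), p' ∈ Zs k ∧ ∃ (d' : ℝ) (t' : ↥Pat → EuclideanSpace ℝ (Fin 3)),
          (0 < d' ∧ 0 < (γ / 2) ∧ ((1 / 20 + η) / 2) < 1 / 20 ∧ (∀ u : ↥Pat, t' u ∈ Zs k ∧ ‖(t' u - p') - d' • A (u : EuclideanSpace ℝ (Fin 3))‖ ≤ ((1 / 20 + η) / 2) * d') ∧ (∀ s : EuclideanSpace ℝ (Fin 3), s ∈ Zs k → s ≠ p' → d' ≤ dist s p') ∧ (∃ s : EuclideanSpace ℝ (Fin 3), s ∈ Zs k ∧ s ≠ p' ∧ dist s p' ≤ d') ∧ (∀ s : EuclideanSpace ℝ (Fin 3), s ∈ Zs k → s ≠ p' → dist s p' < 13 / 10 * d' + (γ / 2) → dist s p' ≤ 13 / 10 * d' - (γ / 2) ∧ s ∈ Set.range t')) := by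
      intro Pat hPat hPatn t hg
      have hγ : 0 < γ := hg.2.1
      have hηd : 0 < (1 / 20 - η) * d := mul_pos (by linarith [hg.2.2.1]) hg.1
      have hε : 0 < min (min (γ / 10) ((1 / 20 - η) * d / 10)) (1 / 10) := by positivity
      obtain ⟨k, hk⟩ := (hconv (‖p‖ + 13 / 10 * d + γ + min (min (γ / 10) ((1 / 20 - η) * d / 10)) (1 / 10)) _ hε).exists
      exact ⟨k, exists_robustGood_of_ballMatch (hZs k).2.1 hPat hPatn hp hg hk⟩
    rcases hgood with ⟨t, hg⟩ | ⟨t, hg⟩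
    · obtain ⟨k, p', hp', d', t', hg'⟩ :=
        key _ (Finset.card_pos.1 (by rw [card_fccKissingPattern]; norm_num)) (fun u hu => norm_eq_one_of_mem_fccKissingPattern hu) t hg
      exact (hZs k).2.2.2 ⟨p', hp', d', (1 / 20 + η) / 2, γ / 2, A, Or.inl ⟨t', hg'⟩⟩
    · obtain ⟨k, p', hp', d', t', hg'⟩ :=
        key _ (Finset.card_pos.1 (by rw [card_hcpKissingPattern]; norm_num)) (fun u hu => norm_eq_one_of_mem_hcpKissingPattern hu) t hg
      exact (hZs k).2.2.2 ⟨p', hp', d', (1 / 20 + η) / 2, γ / 2, A, Or.inr ⟨t', hg'⟩⟩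
  -- the hull engine: a uniformly recurrent member of `𝒞`, which `LCO_rec` endows with a good atom
  obtain ⟨Z, hZ𝒞, hZrec⟩ := exists_mem_uniformlyRecurrent (7 / 10) (by norm_num) 𝒞 ⟨X, hX⟩ (fun Z hZ => hZ.2.1) (fun Z hZ => hZ.1)
    hroot hclosed
  exact hZ𝒞.2.2.2 (hrec Z hZ𝒞.1 hZ𝒞.2.1 hZ𝒞.2.2.1 hZrec)

end Summit.AtomisticToContinuum.Crystallization.Theorems.FrustratedLawDichotomyLocalCloseOrderRecurrent

end
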